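import Mathlib.Algebra.BigOperators.Intervals
import Mathlib.Algebra.Ring.GeomSum
import Mathlib.Tactic.LinearCombination
import Mathlib.Tactic.Ring
import HarnessLib

/-!
# Gaussian periods by kernel-checkable cyclic convolution: the cubic period polynomials of `13` and `103`

Topic `NumberTheory/NumberFields`. For a prime `p ≡ 1 (mod 3)` the three cubic Gaussian periods
`η_i = ∑_{c ∈ gⁱC} ωᶜ` (`ω` a primitive `p`-th root of unity, `C ⊂ (ℤ/p)ˣ` the subgroup of cubes)
are the roots of the cubic *period polynomial*, and `ℚ(η₀)` is the cyclic cubic field of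
conductor `p` (Gauss, *Disquisitiones Arithmeticae* (1801), art. 343–358; for the two cases used
here: `p = 13`, `X³ + X² - 4X + 1`, and `p = 103`, `X³ + X² - 34X - 61`). This file proves these
two identities

* `gaussPeriod13_eq_zero`: `η³ + η² - 4η + 1 = 0` for `η = ω + ω⁵ + ω⁸ + ω¹²`, `ω¹³ = 1`,
  `1 + ω + ⋯ + ω¹² = 0`;
* `gaussPeriod103_eq_zero`: `η³ + η² - 34η - 61 = 0` for `η = ∑_{c ∈ C} ωᶜ`, `C` the `34`
  cubes modulo `103`, `ω¹⁰³ = 1`, `1 + ω + ⋯ + ω¹⁰² = 0`,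

in ANY commutative ring, by reflection: coefficient lists `[a₀, …, a_{n-1}] : List ℕ` are
evaluated at `ω` (`evalCyc`), multiplication modulo `Xⁿ - 1` is the cyclic convolution `mulCyc`
(sound when `ωⁿ = 1`, `evalCyc_mulCyc`), and the statement "`η³ + η²` and
`K·(1 + X + ⋯ + X^{n-1}) + 34·η + 61` have the same coefficient vector modulo `Xⁿ - 1`"
(`K = 5` resp. `381`) is a closed equation of lists decided by the kernel. They serve the explicit
construction of the cubic subfields of `ℚ(ζ₁₃, ζ₁₀₃)` in
`Literature/Barriers/BirchSwinnertonDyer/RankNotSumOfLocalInvariantsF3Cubic*.lean`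
(T. Dokchitser–V. Dokchitser, J. Number Theory 131 (2011), proof of Thm. 2).

## References

* C. F. Gauss, *Disquisitiones Arithmeticae* (1801), Sectio VII, art. 343–358 (periods and their
  equations). [folklore]
* L. C. Washington, *Introduction to Cyclotomic Fields*, 2nd ed., GTM 83 (1997), §16.?/Ex. on
  Gaussian periods; H. Cohen, *A Course in Computational Algebraic Number Theory*, GTM 138,
  §6.4.2 (cyclic cubic fields, the period polynomial). [folklore]
-/

namespace Literature.NumberTheory.NumberFields.GaussianPeriod

open Finset

variable {R : Type*} [CommRing R] (ω : R)

/-! ### Coefficient lists evaluated at `ω` -/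

/-- `evalCyc ω [a₀, a₁, …, a_{m-1}] = ∑ aᵢ ωⁱ` (Horner form). [folklore] -/
def evalCyc : List ℕ → R
  | [] => 0
  | a :: l => (a : R) + ω * evalCyc l

/-- `evalCyc ω [] = 0`. [folklore] -/
@[simp] theorem evalCyc_nil : evalCyc ω [] = 0 := rfl

/-- `evalCyc ω (a :: l) = a + ω · evalCyc ω l`. [folklore] -/
@[simp] theorem evalCyc_cons (a : ℕ) (l : List ℕ) :
    evalCyc ω (a :: l) = (a : R) + ω * evalCyc ω l := rfl

/-- Evaluation of a concatenation: `eval (l₁ ++ l₂) = eval l₁ + ω^{|l₁|} eval l₂`. [folklore] -/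
theorem evalCyc_append (l₁ l₂ : List ℕ) :
    evalCyc ω (l₁ ++ l₂) = evalCyc ω l₁ + ω ^ l₁.length * evalCyc ω l₂ := by
  induction l₁ with
  | nil => simp
  | cons a l ih => rw [List.cons_append, evalCyc_cons, evalCyc_cons, ih, List.length_cons]; ring

/-- Pointwise sum of two coefficient lists (of equal length). [folklore] -/
def addL : List ℕ → List ℕ → List ℕ
  | [], _ => []
  | _ :: _, [] => []
  | a :: l₁, b :: l₂ => (a + b) :: addL l₁ l₂

/-- `eval (l₁ + l₂) = eval l₁ + eval l₂` for lists of equal length. [folklore] -/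
theorem evalCyc_addL : ∀ (l₁ l₂ : List ℕ), l₁.length = l₂.length →
    evalCyc ω (addL l₁ l₂) = evalCyc ω l₁ + evalCyc ω l₂
  | [], [], _ => by simp [addL]
  | [], _ :: _, h => by simp at h
  | _ :: _, [], h => by simp at h
  | a :: l₁, b :: l₂, h => by
    rw [List.length_cons, List.length_cons, Nat.succ_inj] at h
    rw [addL, evalCyc_cons, evalCyc_cons, evalCyc_cons, evalCyc_addL l₁ l₂ h, Nat.cast_add]
    ring

/-- `addL` preserves the (common) length. [folklore] -/
theorem length_addL : ∀ (l₁ l₂ : List ℕ), l₁.length = l₂.length → (addL l₁ l₂).length = l₁.length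
  | [], [], _ => rfl
  | [], _ :: _, h => by simp at h
  | _ :: _, [], h => by simp at h
  | a :: l₁, b :: l₂, h => by
    rw [List.length_cons, List.length_cons, Nat.succ_inj] at h
    rw [addL, List.length_cons, List.length_cons, length_addL l₁ l₂ h]

/-- Scalar multiple of a coefficient list. [folklore] -/
def smulL (c : ℕ) (l : List ℕ) : List ℕ := l.map (c * ·)

/-- `eval (c • l) = c · eval l`. [folklore] -/
theorem evalCyc_smulL (c : ℕ) (l : List ℕ) : evalCyc ω (smulL c l) = (c : R) * evalCyc ω l := by
  induction l with
  | nil => simp [smulL]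
  | cons a l ih =>
    rw [smulL, List.map_cons, evalCyc_cons, evalCyc_cons, ← smulL, ih, Nat.cast_mul]; ring

/-- `smulL` preserves the length. [folklore] -/
@[simp] theorem length_smulL (c : ℕ) (l : List ℕ) : (smulL c l).length = l.length :=
  List.length_map _

/-- Rotation to the right by one place (multiplication by `X` modulo `Xⁿ - 1`):
`[a₀, …, a_{n-1}] ↦ [a_{n-1}, a₀, …, a_{n-2}]`. [folklore] -/
def rotR (l : List ℕ) : List ℕ :=
  match l with
  | [] => []
  | a :: l' => (a :: l').getLast (List.cons_ne_nil a l') :: (a :: l').dropLast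

/-- `rotR` preserves the length. [folklore] -/
theorem length_rotR (l : List ℕ) : (rotR l).length = l.length := by
  cases l with
  | nil => rfl
  | cons a l' =>
    rw [rotR, List.length_cons, List.length_dropLast, List.length_cons]
    rfl

/-- `rotR` of a non-empty list is non-empty. [folklore] -/
theorem rotR_ne_nil {l : List ℕ} (hl : l ≠ []) : rotR l ≠ [] := by
  cases l with
  | nil => exact absurd rfl hl
  | cons a l' => exact List.cons_ne_nil _ _

/-- **Rotation is multiplication by `ω`** when `ω^{|l|} = 1`:
`eval (rotR l) = ω · eval l`. [folklore] -/
theorem evalCyc_rotR {l : List ℕ} (hl : l ≠ []) (hω : ω ^ l.length = 1) :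
    evalCyc ω (rotR l) = ω * evalCyc ω l := by
  obtain ⟨a, l', rfl⟩ := List.exists_cons_of_ne_nil hl
  have hsplit : (a :: l') = (a :: l').dropLast ++ [(a :: l').getLast (List.cons_ne_nil a l')] :=
    (List.dropLast_append_getLast (List.cons_ne_nil a l')).symm
  have hlen : ((a :: l').dropLast).length + 1 = (a :: l').length := by
    rw [List.length_dropLast, List.length_cons]; rfl
  conv_rhs => rw [hsplit]
  rw [rotR, evalCyc_cons, evalCyc_append, evalCyc_cons, evalCyc_nil, mul_zero, add_zero]
  set x := (a :: l').getLast (List.cons_ne_nil a l')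
  set m := (a :: l').dropLast
  have hω' : ω ^ (m.length + 1) = 1 := by rw [hlen]; exact hω
  have key : ω * (ω ^ m.length * (x : R)) = x := by
    rw [← mul_assoc, ← pow_succ', hω', one_mul]
  rw [mul_add, key, add_comm]

/-- **Cyclic convolution** of coefficient lists (multiplication modulo `X^{|b|} - 1`):
`(a₀ + X·a') · b = a₀ b + a' · (X b)`. [folklore] -/
def mulCyc : List ℕ → List ℕ → List ℕ
  | [], b => List.replicate b.length 0
  | a :: l, b => addL (smulL a b) (mulCyc l (rotR b))

/-- `mulCyc a b` has the length of `b`. [folklore] -/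
theorem length_mulCyc : ∀ (a b : List ℕ), (mulCyc a b).length = b.length
  | [], b => by rw [mulCyc, List.length_replicate]
  | a :: l, b => by
    have h : (smulL a b).length = (mulCyc l (rotR b)).length := by
      rw [length_smulL, length_mulCyc l (rotR b), length_rotR]
    rw [mulCyc, length_addL _ _ h, length_smulL]

/-- The zero list evaluates to `0`. [folklore] -/
theorem evalCyc_replicate_zero (n : ℕ) : evalCyc ω (List.replicate n 0) = 0 := by
  induction n with
  | zero => rfl
  | succ n ih => rw [List.replicate_succ, evalCyc_cons, ih, Nat.cast_zero, mul_zero, add_zero]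

/-- **Soundness of the cyclic convolution**: if `ω^{|b|} = 1` then
`eval (mulCyc a b) = eval a · eval b`. [folklore] -/
theorem evalCyc_mulCyc : ∀ (a : List ℕ) {b : List ℕ}, b ≠ [] → ω ^ b.length = 1 →
    evalCyc ω (mulCyc a b) = evalCyc ω a * evalCyc ω b
  | [], b, _, _ => by rw [mulCyc, evalCyc_replicate_zero, evalCyc_nil, zero_mul]
  | a :: l, b, hb, hω => by
    have hlen : (smulL a b).length = (mulCyc l (rotR b)).length := by
      rw [length_smulL, length_mulCyc, length_rotR]
    have hω' : ω ^ (rotR b).length = 1 := by rw [length_rotR]; exact hω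
    rw [mulCyc, evalCyc_addL ω _ _ hlen, evalCyc_smulL, evalCyc_mulCyc l (rotR_ne_nil hb) hω',
      evalCyc_rotR ω hb hω, evalCyc_cons]
    ring

/-- A constant list evaluates to `c · (1 + ω + ⋯ + ω^{n-1})`. [folklore] -/
theorem evalCyc_replicate (n c : ℕ) :
    evalCyc ω (List.replicate n c) = (c : R) * ∑ k ∈ range n, ω ^ k := by
  induction n with
  | zero => simp
  | succ n ih =>
    rw [List.replicate_succ, evalCyc_cons, ih, Finset.sum_range_succ', pow_zero, Finset.mul_sum,
      mul_add, mul_one, add_comm, Finset.mul_sum, Finset.mul_sum]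
    congr 1
    refine Finset.sum_congr rfl fun k _ => ?_
    rw [pow_succ]; ring

/-- The list `[c, 0, …, 0]` evaluates to `c`. [folklore] -/
theorem evalCyc_cons_replicate_zero (c n : ℕ) :
    evalCyc ω (c :: List.replicate n 0) = c := by
  rw [evalCyc_cons, evalCyc_replicate_zero, mul_zero, add_zero]

/-! ### The cubic Gaussian periods of `13` and `103` -/

/-- Indicator list of the cubes `{1, 5, 8, 12}` modulo `13` (index = exponent). [folklore] -/
def ind13 : List ℕ := [0,1,0,0,0,1,0,0,1,0,0,0,1]

/-- Indicator list of the `34` cubes modulo `103` (index = exponent). [folklore] -/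
def ind103 : List ℕ :=
  [0,1,0,1,0,0,0,0,1,1,1,0,0,1,1,0,0,0,0,0,0,0,1,1,1,0,0,1,0,0,1,1,0,0,1,0,0,1,0,1,0,0,1,0,0,0,0,
   0,0,0,0,0,0,0,0,0,0,0,0,0,0,1,0,0,1,0,1,0,0,1,0,0,1,1,0,0,1,0,0,1,1,1,0,0,0,0,0,0,0,1,1,0,0,1,
   1,1,0,0,0,0,1,0,1]

/-- The coefficient identity behind the period polynomial of `13`: modulo `X¹³ - 1`,
`η³ + η² + 1 = 5·(1 + X + ⋯ + X¹²) + 4·η` for `η = X + X⁵ + X⁸ + X¹²` (kernel computation).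
[folklore] -/
theorem ind13_check :
    addL (addL (mulCyc ind13 (mulCyc ind13 ind13)) (mulCyc ind13 ind13))
        (1 :: List.replicate 12 0) =
      addL (List.replicate 13 5) (smulL 4 ind13) := by
  decide +kernel

/-- The coefficient identity behind the period polynomial of `103`: modulo `X¹⁰³ - 1`,
`η³ + η² = 381·(1 + X + ⋯ + X¹⁰²) + 34·η + 61` for `η = ∑_{c cube} Xᶜ` (kernel computation).
[folklore] -/
theorem ind103_check :
    addL (mulCyc ind103 (mulCyc ind103 ind103)) (mulCyc ind103 ind103) =
      addL (addL (List.replicate 103 381) (smulL 34 ind103)) (61 :: List.replicate 102 0) := by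
  decide +kernel

/-- **The cubic period polynomial of `13`** (Gauss): in any commutative ring, if `ω¹³ = 1` and
`1 + ω + ⋯ + ω¹² = 0` (e.g. `ω` a primitive `13`-th root of unity in a domain), then the
Gaussian period `η = ω + ω⁵ + ω⁸ + ω¹²` (cubes modulo `13`) satisfies `η³ + η² - 4η + 1 = 0`.
[folklore] -/
theorem gaussPeriod13_eq_zero (hω : ω ^ 13 = 1) (hS : ∑ k ∈ range 13, ω ^ k = 0) :
    (evalCyc ω ind13) ^ 3 + (evalCyc ω ind13) ^ 2 - 4 * evalCyc ω ind13 + 1 = 0 := by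
  have hne : ind13 ≠ [] := by decide
  have hlen : ind13.length = 13 := rfl
  have hω' : ω ^ ind13.length = 1 := by rw [hlen]; exact hω
  have key := congrArg (evalCyc ω) ind13_check
  have l1 : (mulCyc ind13 (mulCyc ind13 ind13)).length = (mulCyc ind13 ind13).length := by
    rw [length_mulCyc, length_mulCyc]
  have l2 : (addL (mulCyc ind13 (mulCyc ind13 ind13)) (mulCyc ind13 ind13)).length =
      (1 :: List.replicate 12 0).length := by
    rw [length_addL _ _ l1, length_mulCyc, length_mulCyc]; rfl
  have l3 : (List.replicate 13 5).length = (smulL 4 ind13).length := by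
    rw [length_smulL, List.length_replicate]; rfl
  have hm : (mulCyc ind13 ind13) ≠ [] := by
    intro h; have := congrArg List.length h; rw [length_mulCyc, hlen] at this; exact absurd this (by norm_num)
  have hωm : ω ^ (mulCyc ind13 ind13).length = 1 := by rw [length_mulCyc]; exact hω'
  rw [evalCyc_addL ω _ _ l2, evalCyc_addL ω _ _ l1, evalCyc_mulCyc ω _ hm hωm, evalCyc_mulCyc ω _ hne hω',
    evalCyc_cons_replicate_zero, evalCyc_addL ω _ _ l3, evalCyc_replicate, evalCyc_smulL, hS] at key
  push_cast at key
  linear_combination key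

/-- **The cubic period polynomial of `103`** (Gauss): in any commutative ring, if `ω¹⁰³ = 1` and
`1 + ω + ⋯ + ω¹⁰² = 0`, then the Gaussian period `η = ∑_{c ∈ C} ωᶜ` over the `34` cubes `C`
modulo `103` satisfies `η³ + η² - 34η - 61 = 0`. [folklore] -/
theorem gaussPeriod103_eq_zero (hω : ω ^ 103 = 1) (hS : ∑ k ∈ range 103, ω ^ k = 0) :
    (evalCyc ω ind103) ^ 3 + (evalCyc ω ind103) ^ 2 - 34 * evalCyc ω ind103 - 61 = 0 := by
  have hne : ind103 ≠ [] := by decide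
  have hlen : ind103.length = 103 := rfl
  have hω' : ω ^ ind103.length = 1 := by rw [hlen]; exact hω
  have key := congrArg (evalCyc ω) ind103_check
  have l1 : (mulCyc ind103 (mulCyc ind103 ind103)).length = (mulCyc ind103 ind103).length := by
    rw [length_mulCyc, length_mulCyc]
  have l3 : (List.replicate 103 381).length = (smulL 34 ind103).length := by
    rw [length_smulL, List.length_replicate]; rfl
  have l4 : (addL (List.replicate 103 381) (smulL 34 ind103)).length =
      (61 :: List.replicate 102 0).length := by
    rw [length_addL _ _ l3, List.length_replicate]; rfl
  have hm : (mulCyc ind103 ind103) ≠ [] := by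
    intro h; have := congrArg List.length h; rw [length_mulCyc, hlen] at this; exact absurd this (by norm_num)
  have hωm : ω ^ (mulCyc ind103 ind103).length = 1 := by rw [length_mulCyc]; exact hω'
  rw [evalCyc_addL ω _ _ l1, evalCyc_mulCyc ω _ hm hωm, evalCyc_mulCyc ω _ hne hω',
    evalCyc_addL ω _ _ l4, evalCyc_addL ω _ _ l3, evalCyc_replicate, evalCyc_smulL,
    evalCyc_cons_replicate_zero, hS] at key
  push_cast at key
  linear_combination key

end Literature.NumberTheory.NumberFields.GaussianPeriod
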